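import Summits.QuantumFields.YangMills.Theorems.SwapTwistDeficitToronLogShell
import HarnessLib

/-!
# The toron logarithm, III: nearly commuting quadruples of `SU(2)` have Haar volume `≥ c·t⁶·log(1/t)`

★ `haar_pi_nearlyCommuting_ge`: there are `c > 0`, `t₀ > 0` (`c = (2/π²)⁴/(24⁶·32·2 log 4)`, `t₀ = 1/256`) with
`c·t⁶·log t⁻¹ ≤ Haar^{⊗4}{C ∈ SU(2)⁴ | ∀ μ ν, ‖q(C_μ)q(C_ν) − q(C_ν)q(C_μ)‖ ≤ t}` for `0 < t ≤ t₀`, `q = su2Quat`.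
Proof: the shells `ρ_k = 2^{−k}/16`, `δ_k = t/(24ρ_k)`, `k = 0,…,K` with `4^K ≤ 3/(32t) < 4^{K+1}` (`exists_nat_pow_near`) are usable
(`δ_k ≤ ρ_k`), pairwise disjoint (the `im_I`-windows of `x 0` are), each projects into the event (✓`shellSet_subset`) and has product cone mass
`c⁴(t/24)⁶/32` (✓`pi_coneMeasure_shellSet`); `K + 1 ≥ log t⁻¹/(2 log 4)` for `t ≤ 1/256`; transport to Haar by ✓`measurePreserving_proj`.
WHY IT MATTERS (memo `SWAP-STRATA-23802-w2g54.md`, evidence #2 on ⟨stmt-QuantumFields-23802⟩): on a comb-gauged periodic `SU(2)` lattice the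
Wilson action restricted to the four seam letters is the commutator quartic, so this is the zero-mode factor `β⁻³ log β` (`t = Kβ^{−1/2}`) of the
periodic toron floor `Z ≳ e^{12βL⁴}β^{−(9L⁴−3/2)} log β` (brick (A)); for THREE letters (the swap-glued ring) the same shells give `t⁴·Σ_k ρ_k`,
a geometric sum — no logarithm — which is the mechanism behind `⟨S⟩ → 0` in ⟨23802⟩.
HONEST LABEL: finite-dimensional volume bookkeeping; nothing about ⟨23802⟩/⟨24196⟩ or any rung is proved; the Yang–Mills mass gap is NOT
proved; no summit is proved by a line.  Width seat ym-line-sfw-p2-w2 g54 (cell ym-idea-1, free hands; `--supports stmt-QuantumFields-23802`).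
THEOREMS ONLY (0 `def`), 0 `sorry`, standard axioms.  References: [cite: Vanbaal2001]; [cite: Luscher1983, §2]; [folklore].
-/

set_option autoImplicit false

noncomputable section

open MeasureTheory Quaternion Set
open scoped Quaternion ENNReal BigOperators
open Literature.MathematicalPhysics.QuantumLattice
open Literature.MathematicalPhysics.QuantumFieldTheory (haarProbability)

attribute [local instance] Literature.Analysis.FluidPDE.Tao2016.quatMeasurableSpace
  Literature.Analysis.FluidPDE.Tao2016.quatBorelSpace
  Literature.MathematicalPhysics.QuantumLattice.secondCountableTopology_su2

namespace Summit.QuantumFields.YangMills.Theorems.SwapTwistDeficit.ToronLog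

/-! ## §8 Dyadic shells and the toron logarithm -/

/-- `ρ_k > 0`. [folklore] -/
theorem shellRadius_pos (k : ℕ) : 0 < shellRadius k := by unfold shellRadius; positivity

/-- `ρ_k ≤ 1/16`. [folklore] -/
theorem shellRadius_le (k : ℕ) : shellRadius k ≤ 1 / 16 := by
  unfold shellRadius
  have : (1 / 2 : ℝ) ^ k ≤ 1 := pow_le_one₀ (by norm_num) (by norm_num)
  linarith

/-- `ρ_l ≤ ρ_k/2` for `k < l`. [folklore] -/
theorem shellRadius_le_half {k l : ℕ} (h : k < l) : shellRadius l ≤ shellRadius k / 2 := by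
  unfold shellRadius
  have h1 : (1 / 2 : ℝ) ^ l ≤ (1 / 2) ^ (k + 1) := pow_le_pow_of_le_one (by norm_num) (by norm_num) h
  rw [pow_succ] at h1
  linarith

/-- `ρ_k² = (3/32)·4^{-k}/24`, i.e. `24ρ_k² = 3/(32·4^k)`. [folklore] -/
theorem shellRadius_sq (k : ℕ) : 24 * shellRadius k ^ 2 = 3 / (32 * 4 ^ k) := by
  unfold shellRadius
  have h : ((1 : ℝ) / 2) ^ k * (1 / 2) ^ k * 4 ^ k = 1 := by
    rw [← mul_pow, ← mul_pow]; norm_num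
  rw [eq_div_iff (by positivity)]
  calc 24 * (1 / 16 * ((1 : ℝ) / 2) ^ k) ^ 2 * (32 * 4 ^ k) = 3 * ((1 / 2) ^ k * (1 / 2) ^ k * 4 ^ k) := by ring
    _ = 3 := by rw [h, mul_one]

/-- `ρ_k δ_k = t/24`. [folklore] -/
theorem shellRadius_mul_shellWidth (t : ℝ) (k : ℕ) : shellRadius k * shellWidth t k = t / 24 := by
  unfold shellWidth
  have := (shellRadius_pos k).ne'
  field_simp

/-- `δ_k ≤ ρ_k` as soon as `t ≤ 24ρ_k²`. [folklore] -/
theorem shellWidth_le {t : ℝ} {k : ℕ} (h : t ≤ 24 * shellRadius k ^ 2) : shellWidth t k ≤ shellRadius k := by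
  unfold shellWidth
  rw [div_le_iff₀ (by have := shellRadius_pos k; positivity)]
  nlinarith

/-- Different shells are disjoint (the `im_I`-windows `[ρ_k, 3ρ_k/2]` of `x 0` are disjoint). [folklore] -/
theorem disjoint_shellSet {k l : ℕ} (hkl : k ≠ l) (δ δ' : ℝ) :
    Disjoint (shellSet (shellRadius k) δ) (shellSet (shellRadius l) δ') := by
  rw [Set.disjoint_left]
  intro x hx hx'
  have h1 := (mem_axis_iff.1 hx.1).2.2
  have h2 := (mem_axis_iff.1 hx'.1).2.2
  rcases Nat.lt_or_gt_of_ne hkl with h | h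
  · have := shellRadius_le_half h
    have := shellRadius_pos k
    linarith [h1.1, h2.2.1]
  · have := shellRadius_le_half h
    have := shellRadius_pos l
    linarith [h2.1, h1.2.1]

/-- The nearly-commuting event is measurable. [folklore] -/
theorem measurableSet_nearlyCommuting (t : ℝ) : MeasurableSet (nearlyCommuting t) := by
  have hq : ∀ μ : Fin 4, Measurable fun C : Fin 4 → (Matrix.specialUnitaryGroup (Fin 2) ℂ) => su2Quat (C μ) := fun μ =>
    Literature.MathematicalPhysics.QuantumFieldTheory.Balaban1983to89.T4HaarSU2Translate.measurable_su2Quat.comp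
      (measurable_pi_apply μ)
  have h : ∀ μ ν : Fin 4, MeasurableSet
      {C : Fin 4 → (Matrix.specialUnitaryGroup (Fin 2) ℂ) | ‖su2Quat (C μ) * su2Quat (C ν) - su2Quat (C ν) * su2Quat (C μ)‖ ≤ t} := fun μ ν =>
    measurableSet_le (((hq μ).mul (hq ν)).sub ((hq ν).mul (hq μ))).norm measurable_const
  have e : nearlyCommuting t = ⋂ μ : Fin 4, ⋂ ν : Fin 4,
      {C : Fin 4 → (Matrix.specialUnitaryGroup (Fin 2) ℂ) | ‖su2Quat (C μ) * su2Quat (C ν) - su2Quat (C ν) * su2Quat (C μ)‖ ≤ t} := by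
    ext C
    simp [nearlyCommuting]
  rw [e]
  exact MeasurableSet.iInter fun μ => MeasurableSet.iInter fun ν => h μ ν

/-- A usable shell projects into the nearly-commuting event. [folklore] -/
theorem shellSet_subset_preimage {t : ℝ} (ht : 0 ≤ t) {k : ℕ} (hk : t ≤ 24 * shellRadius k ^ 2) :
    shellSet (shellRadius k) (shellWidth t k) ⊆
      (fun (x : Fin 4 → ℍ) (μ : Fin 4) => quatToSU2 (x μ)) ⁻¹' nearlyCommuting t := by
  intro x hx
  have hδ : 0 ≤ shellWidth t k := by
    unfold shellWidth; have := shellRadius_pos k; positivity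
  have h := (shellSet_subset (shellRadius_pos k) (shellRadius_le k) hδ (shellWidth_le hk) hx).2
  intro μ ν
  have e : 24 * shellRadius k * shellWidth t k = t := by
    rw [mul_assoc, shellRadius_mul_shellWidth]; ring
  simpa only [e] using h μ ν

/-- **Shell count**: the product cone measure of the letters projecting into the nearly-commuting event is at least
`(K+1)·c⁴(t/24)⁶/32` whenever the shells `0, …, K` are usable (`4^K ≤ 3/(32t)`). [folklore] -/
theorem sum_shells_le {t : ℝ} (ht : 0 ≤ t) {K : ℕ} (hK : (4 : ℝ) ^ K ≤ 3 / (32 * t)) (ht0 : 0 < t) :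
    ((K + 1 : ℕ) : ℝ≥0∞) * ENNReal.ofReal (coneConst ^ 4 * ((t / 24) ^ 6 / 32)) ≤
      (Measure.pi fun _ : Fin 4 => coneMeasure)
        ((fun (x : Fin 4 → ℍ) (μ : Fin 4) => quatToSU2 (x μ)) ⁻¹' nearlyCommuting t) := by
  -- usable shells
  have husable : ∀ k ∈ Finset.range (K + 1), t ≤ 24 * shellRadius k ^ 2 := by
    intro k hk
    rw [Finset.mem_range] at hk
    rw [shellRadius_sq]
    have h4k : (4 : ℝ) ^ k ≤ 4 ^ K := pow_le_pow_right₀ (by norm_num) (by omega)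
    have h4pos : (0 : ℝ) < 4 ^ k := by positivity
    rw [le_div_iff₀ (by positivity)]
    rw [le_div_iff₀ (by positivity)] at hK
    nlinarith
  calc ((K + 1 : ℕ) : ℝ≥0∞) * ENNReal.ofReal (coneConst ^ 4 * ((t / 24) ^ 6 / 32))
      = ∑ k ∈ Finset.range (K + 1), (Measure.pi fun _ : Fin 4 => coneMeasure)
          (shellSet (shellRadius k) (shellWidth t k)) := by
        rw [Finset.sum_congr rfl fun k hk => ?_, Finset.sum_const, Finset.card_range, nsmul_eq_mul]
        have hδ : 0 ≤ shellWidth t k := by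
          unfold shellWidth; have := shellRadius_pos k; positivity
        rw [pi_coneMeasure_shellSet (shellRadius_pos k) (shellRadius_le k) hδ (shellWidth_le (husable k hk)),
          shellRadius_mul_shellWidth]
    _ = (Measure.pi fun _ : Fin 4 => coneMeasure) (⋃ k ∈ Finset.range (K + 1), shellSet (shellRadius k) (shellWidth t k)) := by
        rw [measure_biUnion_finset]
        · intro k _ l _ hkl
          exact disjoint_shellSet hkl _ _
        · intro k _
          exact measurableSet_shellSet _ _
    _ ≤ _ := by
        refine measure_mono (Set.iUnion₂_subset fun k hk => ?_)
        exact shellSet_subset_preimage ht (husable k hk)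

/-- **THE TORON LOGARITHM.**  There are `c > 0` and `t₀ > 0` such that for `0 < t ≤ t₀` the product Haar measure of the quadruples
`(C_μ) ∈ SU(2)⁴` whose unit quaternions pairwise commute up to `t`, `‖q(C_μ)q(C_ν) − q(C_ν)q(C_μ)‖ ≤ t` for all `μ, ν`, is at least
`c·t⁶·log(1/t)` (here `c = (2/π²)⁴/(24⁶·32·2 log 4)`, `t₀ = 1/256`).  The zero-mode volume behind the extra `log β` of the periodic
`SU(2)` toron floor. [folklore] -/
theorem haar_pi_nearlyCommuting_ge :
    ∃ c : ℝ, 0 < c ∧ ∃ t₀ : ℝ, 0 < t₀ ∧ ∀ t : ℝ, 0 < t → t ≤ t₀ →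
      c * t ^ 6 * Real.log t⁻¹ ≤
        (Measure.pi fun _ : Fin 4 => haarProbability (Matrix.specialUnitaryGroup (Fin 2) ℂ)).real
          {C : Fin 4 → (Matrix.specialUnitaryGroup (Fin 2) ℂ) | ∀ μ ν : Fin 4, ‖su2Quat (C μ) * su2Quat (C ν) - su2Quat (C ν) * su2Quat (C μ)‖ ≤ t} := by
  have hlog4 : 0 < Real.log 4 := Real.log_pos (by norm_num)
  refine ⟨coneConst ^ 4 / (24 ^ 6 * 32) / (2 * Real.log 4), by have := coneConst_pos; positivity, 1 / 256, by norm_num,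
    fun t ht ht₀ => ?_⟩
  haveI := isProbabilityMeasure_coneMeasure
  -- the number of usable shells
  set X : ℝ := 3 / (32 * t) with hXdef
  have hX1 : 1 ≤ X := by
    rw [hXdef, le_div_iff₀ (by positivity)]; linarith
  have hXpos : 0 < X := lt_of_lt_of_le one_pos hX1
  obtain ⟨K, hK1, hK2⟩ := exists_nat_pow_near hX1 (by norm_num : (1 : ℝ) < 4)
  -- `K + 1 ≥ log(1/t)/(2 log 4)`
  have hKlog : Real.log t⁻¹ / (2 * Real.log 4) ≤ (K + 1 : ℕ) := by
    have h1 : Real.log X < ((K + 1 : ℕ) : ℝ) * Real.log 4 := by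
      have := Real.log_lt_log hXpos hK2
      rwa [Real.log_pow] at this
    have h2 : Real.log t⁻¹ - Real.log 16 ≤ Real.log X := by
      rw [← Real.log_div (inv_ne_zero ht.ne') (by norm_num)]
      refine Real.log_le_log (by positivity) ?_
      rw [hXdef, div_le_div_iff₀ (by norm_num) (by positivity)]
      field_simp
      nlinarith
    have h3 : Real.log 16 ≤ Real.log t⁻¹ / 2 := by
      have h256 : (256 : ℝ) ≤ t⁻¹ := by
        rw [le_inv_comm₀ (by norm_num) ht]; linarith
      have hl := Real.log_le_log (by norm_num) h256
      rw [show (256 : ℝ) = 16 ^ 2 by norm_num, Real.log_pow] at hl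
      push_cast at hl
      linarith
    rw [div_le_iff₀ (by positivity)]
    nlinarith
  -- the measure bound in `ℝ≥0∞`
  have hmain := sum_shells_le ht.le hK1 ht
  have hE := measurableSet_nearlyCommuting t
  rw [measurePreserving_proj.measure_preimage hE.nullMeasurableSet] at hmain
  -- pass to real numbers
  have hfin : (Measure.pi fun _ : Fin 4 => haarProbability (Matrix.specialUnitaryGroup (Fin 2) ℂ)) (nearlyCommuting t) ≠ ∞ := measure_ne_top _ _
  have hv : 0 ≤ coneConst ^ 4 * ((t / 24) ^ 6 / 32) := by have := coneConst_pos; positivity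
  have hreal : ((K + 1 : ℕ) : ℝ) * (coneConst ^ 4 * ((t / 24) ^ 6 / 32)) ≤
      ((Measure.pi fun _ : Fin 4 => haarProbability (Matrix.specialUnitaryGroup (Fin 2) ℂ)) (nearlyCommuting t)).toReal := by
    rw [← ENNReal.ofReal_le_iff_le_toReal hfin, ENNReal.ofReal_mul (by positivity), ENNReal.ofReal_natCast]
    exact hmain
  show _ ≤ ((Measure.pi fun _ : Fin 4 => haarProbability (Matrix.specialUnitaryGroup (Fin 2) ℂ)) (nearlyCommuting t)).toReal
  refine le_trans ?_ hreal
  have hlogt : 0 ≤ Real.log t⁻¹ := Real.log_nonneg (by rw [le_inv_comm₀ one_pos ht, inv_one]; linarith)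
  calc coneConst ^ 4 / (24 ^ 6 * 32) / (2 * Real.log 4) * t ^ 6 * Real.log t⁻¹
      = Real.log t⁻¹ / (2 * Real.log 4) * (coneConst ^ 4 * ((t / 24) ^ 6 / 32)) := by
        field_simp
    _ ≤ ((K + 1 : ℕ) : ℝ) * (coneConst ^ 4 * ((t / 24) ^ 6 / 32)) :=
        mul_le_mul_of_nonneg_right hKlog hv

end Summit.QuantumFields.YangMills.Theorems.SwapTwistDeficit.ToronLog

end
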